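import Literature.Analysis.FluidPDE.NSRobustnessOfRegularityH2
import HarnessLib

/-!
# Robustness of regularity on `ℝ³` in strain currency: the packaged sup-norm door on a window

Analysis/FluidPDE proof file (theorems only; no definitions, no named facts, no `sorry`); third
file of the vein `NSRobustnessOfRegularity` (`H¹`, RRS 2016 Thm 9.1 / Dashti–Robinson 2008
Thm 1) → `NSRobustnessOfRegularityH2` (`H²`, Dashti–Robinson Thm 2) — split off only because of
the proposal size cap; the private slice bookkeeping is repeated verbatim.

* `IsClassicalNSSolutionOn.lintegral_enorm_sq_fderiv_force_lt_top` — the force of a classical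
  solution of the `L²`-Sobolev class has `Df(t) ∈ L²` on every slice (generic time set of unique
  differentiability): `Df = D∂ₜu + D[(u·∇)u] − νDΔu + D∇p`, `‖DΔu‖ ≤ 3‖D³u‖`, `‖D∇p‖ ≤ ‖D²p‖`,
  `‖D[(u·∇)u]‖ ≤ ‖u‖_∞‖D²u‖ + ‖Du‖_∞‖Du‖`. Discharges the hypotheses `hfD`, `hgD` of the `H²`
  theorems from the class.
* `classicalNS_robustness_H2_strain_window_of_le_R3` — the window form of the `H²` strain
  theorem (`classicalNS_robustness_H2_strain_window_R3`) with MAJORANTS `D₂ ≥ Z(t₀)`,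
  `Ψ₂ ≥ ∫_{t₀}^{t₁}ψ` of the two defects (the literal certificate shape; the Riccati bound
  `e^{Λ}η/(1 − βe^{Λ(t₁)}η(t − t₀))` is monotone in `η`).
* `classicalNS_norm_sub_le_strain_window_R3` — **the packaged sup-norm distance on a window**:
  for two classical solutions `(u, p)` (force `f`, the reference) and `(v, q)` (force `g`) of the
  class on `[t₀, t₁] × ℝ³`, continuous majorants `G` (compression rate of `Du`),
  `σ₂ ≥ ‖D²u‖_∞`, `σ₃ ≥ ‖D³u‖_∞`, `L ≥ ‖v − u‖_{L²}`, `X₁`, `H₁ ≥ ∫‖D(f − g)‖²`, sources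
  `ψ₁ ≥ (2/ν)‖f − g‖² + 3σ₂L²/κ`, `ψ₂ ≥ 27σ₂X₁/κ + 9σ₃L²/κ² + 6H₁/ν`, defect majorants
  `D₁, Ψ₁, D₂, Ψ₂`, `X₁` dominating the `H¹` certificate bound
  `e^{Λ₁(s)}(D₁ + Ψ₁)/√(1 − 2β₁e^{2Λ₁(t₁)}(D₁ + Ψ₁)²(s − t₀))` (`Λ₁ = ∫(4G + 3κσ₂)`,
  `β₁ = A⁴/(2ν³)`), and the two real smallness inequalities: for `t ∈ [t₀, t₁]` and every `x`,
  `‖v(t,x) − u(t,x)‖ ≤ A(3X₁(t)·e^{Λ₂(t)}(D₂ + Ψ₂)/(1 − β₂e^{Λ₂(t₁)}(D₂ + Ψ₂)(t − t₀)))^{1/4}`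
  (`Λ₂ = ∫(6G + 9κσ₂ + 3κ²σ₃ + 3A²X₁/(νμ) + 27A⁴X₁²/(16ν³))`, `β₂ = A²μ/ν`, `A = agmonConst`) —
  the `H¹` certificate `classicalNS_robustness_strain_window_of_le_R3`, the `H²` certificate
  above and the Agmon readout `norm_le_agmonConst_mul_rpow_of_le` composed. Every hypothesis is
  a class hypothesis on the two solutions, a pointwise majorant on `[t₀, t₁]`, or a real
  inequality; a-priori (both solutions given) — the existence half is not here.
* `classicalNS_norm_sub_le_strain_window_half_R3` — the same under HALF-smallness (both products
  `≤ 1/2`) with `X₁ ≥ √2·e^{Λ₁}(D₁ + Ψ₁)`, in closed form: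
  `‖v(t,x) − u(t,x)‖ ≤ A(3X₁(t)·2e^{Λ₂(t)}(D₂ + Ψ₂))^{1/4}` (the readable price: fee
  `e^{(Λ₁+Λ₂)/4}` in strain times, defects through fourth roots).

Consumer: cell `ns-blowup`, route `PalasekTowerBreakdown`, cruxes 19179 `EpisodeBase` / 20303
`EpisodeBaseT`, strain-currency door. WHAT THIS IS NOT: not a statement about Navier–Stokes
regularity or blow-up — a-priori calculus between two given classical solutions.

## Mathlib / tree search

Tree: the two preceding files of the vein; `norm_iteratedFDeriv_clm_apply_const` (Mathlib),
`fderiv_laplacian_apply_of_contDiff_three`, `fderiv_convect_apply_eqOn`,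
`exists_forall_norm_fderiv_le_of_hasBoundedSobolevNormsOn`, `linfty_bound_of_hasBoundedSobolevNormsOn_holds`.

## References

* M. Dashti, J. C. Robinson, SIAM J. Numer. Anal. 46 (2008) 3136–3150 (arXiv:math/0701341),
  Lemma 1, Thm 1, Thm 2 (pp. 4, 6–7). [DashtiRobinson2008]
* J. C. Robinson, J. L. Rodrigo, W. Sadowski, *The Three-Dimensional Navier–Stokes Equations*,
  CUP 2016, Thm 1.20 (Agmon), Thm 9.1 (pp. 180–182). [RobinsonRodrigoSadowskiCUP2016]
-/

noncomputable section

open MeasureTheory Set Function Filter Topology InnerProductSpace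
open scoped ENNReal NNReal ContDiff RealInnerProductSpace Laplacian

namespace Literature.Analysis.FluidPDE

/-! ## §A Bookkeeping repeated from the preceding files (private) -/

section Helpers

/-- `∫⁻‖a + b‖² < ∞` from `∫⁻‖a‖², ∫⁻‖b‖² < ∞`. [folklore] -/
private theorem r3rob_lintegral_sq_add_lt_top {G : Type*} [NormedAddCommGroup G]
    {a b : EuclideanSpace ℝ (Fin 3) → G}
    (ham : AEStronglyMeasurable a volume) (ha : ∫⁻ x, ‖a x‖ₑ ^ 2 < ⊤)
    (hb : ∫⁻ x, ‖b x‖ₑ ^ 2 < ⊤) : ∫⁻ x, ‖a x + b x‖ₑ ^ 2 < ⊤ := by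
  have h := lintegral_enorm_sq_sub_le (g := fun x => -b x) ham (μ := volume)
  have e : ∀ x, a x + b x = a x - -b x := fun x => by rw [sub_neg_eq_add]
  simp_rw [e]
  refine lt_of_le_of_lt h ?_
  simp_rw [enorm_neg]
  exact ENNReal.add_lt_top.2 ⟨ENNReal.mul_lt_top (by simp) ha, ENNReal.mul_lt_top (by simp) hb⟩

/-- `∫⁻‖a − b‖² < ∞` from `∫⁻‖a‖², ∫⁻‖b‖² < ∞`. [folklore] -/
private theorem r3rob_lintegral_sq_sub_lt_top {G : Type*} [NormedAddCommGroup G]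
    {a b : EuclideanSpace ℝ (Fin 3) → G}
    (ham : AEStronglyMeasurable a volume) (ha : ∫⁻ x, ‖a x‖ₑ ^ 2 < ⊤)
    (hb : ∫⁻ x, ‖b x‖ₑ ^ 2 < ⊤) : ∫⁻ x, ‖a x - b x‖ₑ ^ 2 < ⊤ :=
  lt_of_le_of_lt (lintegral_enorm_sq_sub_le (g := b) ham (μ := volume))
    (ENNReal.add_lt_top.2 ⟨ENNReal.mul_lt_top (by simp) ha, ENNReal.mul_lt_top (by simp) hb⟩)

/-- `∫⁻‖c • a‖² < ∞` from `∫⁻‖a‖² < ∞`. [folklore] -/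
private theorem r3rob_lintegral_sq_smul_lt_top {G : Type*} [NormedAddCommGroup G] [NormedSpace ℝ G]
    {a : EuclideanSpace ℝ (Fin 3) → G} (c : ℝ) (ha : ∫⁻ x, ‖a x‖ₑ ^ 2 < ⊤) : ∫⁻ x, ‖c • a x‖ₑ ^ 2 <
    ⊤ := by
  have e : ∀ x, ‖c • a x‖ₑ ^ 2 = ‖c‖ₑ ^ 2 * ‖a x‖ₑ ^ 2 := fun x => by rw [enorm_smul, mul_pow]
  simp_rw [e]
  rw [lintegral_const_mul' _ _ (ENNReal.pow_ne_top enorm_ne_top)]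
  exact ENNReal.mul_lt_top (lt_top_iff_ne_top.2 (ENNReal.pow_ne_top enorm_ne_top)) ha

/-- `∫⁻‖c‖a‖‖² < ∞` from `∫⁻‖a‖² < ∞` (real-valued majorant form). [folklore] -/
private theorem r3rob_lintegral_sq_mul_norm_lt_top {G : Type*} [NormedAddCommGroup G]
    {a : EuclideanSpace ℝ (Fin 3) → G}
    (c : ℝ) (ha : ∫⁻ x, ‖a x‖ₑ ^ 2 < ⊤) : ∫⁻ x, ‖c * ‖a x‖‖ₑ ^ 2 < ⊤ := by
  have e : ∀ x, ‖c * ‖a x‖‖ₑ ^ 2 = ‖c‖ₑ ^ 2 * ‖a x‖ₑ ^ 2 := fun x => by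
    rw [enorm_mul, mul_pow, enorm_norm]
  simp_rw [e]
  rw [lintegral_const_mul' _ _ (ENNReal.pow_ne_top enorm_ne_top)]
  exact ENNReal.mul_lt_top (lt_top_iff_ne_top.2 (ENNReal.pow_ne_top enorm_ne_top)) ha

/-- Uniform `L²`-Sobolev bounds pass to slicewise differences: if `c(t) = a(t) − b(t)` on `S` with
smooth slices and `a, b` have all `L²` Sobolev norms bounded on `S`, so does `c`. [folklore] -/
private theorem r3rob_sobolev_sub {F : Type*} [NormedAddCommGroup F] [NormedSpace ℝ F]
    {S : Set ℝ} {a b c : ℝ → EuclideanSpace ℝ (Fin 3) → F}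
    (habc : ∀ t ∈ S, ∀ x, c t x = a t x - b t x) (ha : ∀ t ∈ S, ContDiff ℝ ∞ (a t))
    (hb : ∀ t ∈ S, ContDiff ℝ ∞ (b t))
    (hA : ∀ n : ℕ, ∃ C : ℝ≥0, ∀ t ∈ S, ∫⁻ x, ‖iteratedFDeriv ℝ n (a t) x‖ₑ ^ 2 ≤ C)
    (hB : ∀ n : ℕ, ∃ C : ℝ≥0, ∀ t ∈ S, ∫⁻ x, ‖iteratedFDeriv ℝ n (b t) x‖ₑ ^ 2 ≤ C) (n : ℕ) :
    ∃ C : ℝ≥0, ∀ t ∈ S, ∫⁻ x, ‖iteratedFDeriv ℝ n (c t) x‖ₑ ^ 2 ≤ C := by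
  obtain ⟨Ca, hCa⟩ := hA n
  obtain ⟨Cb, hCb⟩ := hB n
  refine ⟨2 * Ca + 2 * Cb, fun t ht => ?_⟩
  have hc : c t = a t - b t := funext fun x => by rw [Pi.sub_apply, habc t ht x]
  have hsub : ∀ x, iteratedFDeriv ℝ n (c t) x = iteratedFDeriv ℝ n (a t) x - iteratedFDeriv ℝ n (b t) x :=
    fun x => by
      rw [hc]
      exact iteratedFDeriv_sub_apply ((ha t ht).of_le (by exact_mod_cast le_top)).contDiffAt
        ((hb t ht).of_le (by exact_mod_cast le_top)).contDiffAt
  have hm : AEStronglyMeasurable (fun x => iteratedFDeriv ℝ n (a t) x) volume :=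
    ((ha t ht).continuous_iteratedFDeriv (by exact_mod_cast le_top)).aestronglyMeasurable
  calc ∫⁻ x, ‖iteratedFDeriv ℝ n (c t) x‖ₑ ^ 2
      = ∫⁻ x, ‖iteratedFDeriv ℝ n (a t) x - iteratedFDeriv ℝ n (b t) x‖ₑ ^ 2 :=
        lintegral_congr fun x => by rw [hsub]
    _ ≤ 2 * (∫⁻ x, ‖iteratedFDeriv ℝ n (a t) x‖ₑ ^ 2) + 2 * ∫⁻ x, ‖iteratedFDeriv ℝ n (b t) x‖ₑ ^ 2 :=
        lintegral_enorm_sq_sub_le hm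
    _ ≤ 2 * (Ca : ℝ≥0∞) + 2 * (Cb : ℝ≥0∞) := by
        gcongr
        · exact hCa t ht
        · exact hCb t ht
    _ = ((2 * Ca + 2 * Cb : ℝ≥0) : ℝ≥0∞) := by push_cast; rfl

/-- Uniform-in-time Sobolev bound, at one time: `∫⁻‖Dⁿ(c t)‖² < ∞`. [folklore] -/
private theorem r3rob_fin {F : Type*} [NormedAddCommGroup F] [NormedSpace ℝ F] {S : Set ℝ}
    {c : ℝ → EuclideanSpace ℝ (Fin 3) → F} {t : ℝ} (ht : t ∈ S) (n : ℕ)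
    (hC : ∃ C : ℝ≥0, ∀ s ∈ S, ∫⁻ x, ‖iteratedFDeriv ℝ n (c s) x‖ₑ ^ 2 ≤ C) :
    ∫⁻ x, ‖iteratedFDeriv ℝ n (c t) x‖ₑ ^ 2 < ⊤ := by
  obtain ⟨C, hC⟩ := hC
  exact lt_of_le_of_lt (hC t ht) ENNReal.coe_lt_top

/-- **`∂ᵥ∇π = ∇∂ᵥπ`** for a `C²` scalar field on `ℝ³` (Schwarz). [folklore] -/
private theorem r3rob_fderiv_gradient_apply {π : EuclideanSpace ℝ (Fin 3) → ℝ} (hπ : ContDiff ℝ 2 π)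
    (x v : EuclideanSpace ℝ (Fin 3)) :
    fderiv ℝ (gradient π) x v = gradient (fun y => fderiv ℝ π y v) x := by
  have hd : DifferentiableAt ℝ (fderiv ℝ π) x :=
    ((hπ.fderiv_right (m := 1) (by norm_num)).differentiable one_ne_zero) x
  have hdg : DifferentiableAt ℝ (gradient π) x := by
    show DifferentiableAt ℝ
      (fun y => (InnerProductSpace.toDual ℝ (EuclideanSpace ℝ (Fin 3))).symm (fderiv ℝ π y)) x
    exact ((InnerProductSpace.toDual ℝ (EuclideanSpace ℝ (Fin 3))).symm.differentiable.differentiableAt).comp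
      x hd
  refine ext_inner_right ℝ fun a => ?_
  have key : ∀ (φ : EuclideanSpace ℝ (Fin 3) → ℝ) (y : EuclideanSpace ℝ (Fin 3)),
      ⟪gradient φ y, a⟫ = fderiv ℝ φ y a := fun φ y => by
    rw [gradient, InnerProductSpace.toDual_symm_apply]
  have h1 : fderiv ℝ (fun y => ⟪gradient π y, a⟫) x v = ⟪fderiv ℝ (gradient π) x v, a⟫ := by
    rw [fderiv_inner_apply ℝ hdg (differentiableAt_const a)]
    simp
  have h2 : (fun y => ⟪gradient π y, a⟫) = fun y => fderiv ℝ π y a := funext fun y => key π y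
  rw [← h1, h2, key, fderiv_fderiv_apply_comm_of_contDiff_two hπ x a v]

/-- **The product rule for the convective term** on `ℝ³` (smooth fields):
`∂ₑ((a·∇)b) = Db(∂ₑa) + (a·∇)(∂ₑb)` (the tree's `fderiv_convect_apply_eqOn` on `univ`). [folklore] -/
private theorem fderiv_convect_apply_of_contDiff
    {a b : EuclideanSpace ℝ (Fin 3) → EuclideanSpace ℝ (Fin 3)} (ha : ContDiff ℝ ∞ a)
    (hb : ContDiff ℝ ∞ b)
    (x ξ : EuclideanSpace ℝ (Fin 3)) :
    fderiv ℝ (convect a b) x ξ =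
      fderiv ℝ b x (fderiv ℝ a x ξ) + convect a (fun y => fderiv ℝ b y ξ) x := by
  have h := fderiv_convect_apply_eqOn isOpen_univ ha.contDiffOn hb.contDiffOn ξ (mem_univ x)
  simpa [convect] using h

end Helpers

/-! ## §B The derivative of the force of a classical solution of the class is in `L²` -/

section ForceDerivative

variable {S : Set ℝ} {ν : ℝ} {f u : ℝ → EuclideanSpace ℝ (Fin 3) → EuclideanSpace ℝ (Fin 3)}
variable {p : ℝ → EuclideanSpace ℝ (Fin 3) → ℝ}

/-- **The force of a classical solution of the `L²`-Sobolev class has square-integrable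
derivative on every slice** (discharges the hypotheses `hfD`, `hgD` of the `H²` theorems):
`Df = D∂ₜu + D[(u·∇)u] − νDΔu + D∇p` with `‖DΔu‖ ≤ 3‖D³u‖`, `‖D∇p‖ ≤ ‖D²p‖`,
`‖D[(u·∇)u]‖ ≤ ‖u‖_∞‖D²u‖ + ‖Du‖_∞‖Du‖`, all in `L²` (class; `H² ⊂ C_B`). [folklore]
[cite: DashtiRobinson2008, Thm 2 (setting)] -/
theorem IsClassicalNSSolutionOn.lintegral_enorm_sq_fderiv_force_lt_top (hS : UniqueDiffOn ℝ S)
    (hu : IsClassicalNSSolutionOn S ν f u p) (hU : HasBoundedSobolevNormsOn S u)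
    (hUt : HasBoundedSobolevNormsOn S (timeDerivWithin S u))
    (hp : ∀ n : ℕ, ∃ C : ℝ≥0, ∀ t ∈ S, ∫⁻ x, ‖iteratedFDeriv ℝ n (p t) x‖ₑ ^ 2 ≤ C)
    {t : ℝ} (ht : t ∈ S) : ∫⁻ x, ‖fderiv ℝ (f t) x‖ₑ ^ 2 < ⊤ := by
  obtain ⟨U, hUdef⟩ : ∃ U : EuclideanSpace ℝ (Fin 3) → EuclideanSpace ℝ (Fin 3), U = u t := ⟨_, rfl⟩
  obtain ⟨W, hWdef⟩ : ∃ W : EuclideanSpace ℝ (Fin 3) → EuclideanSpace ℝ (Fin 3),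
      W = timeDerivWithin S u t := ⟨_, rfl⟩
  obtain ⟨P, hPdef⟩ : ∃ P : EuclideanSpace ℝ (Fin 3) → ℝ, P = p t := ⟨_, rfl⟩
  have hUs : ContDiff ℝ ∞ U := by rw [hUdef]; exact hu.contDiff_velocity ht
  have hU3 : ContDiff ℝ 3 U := hUs.of_le (by norm_cast)
  have hU1 : ContDiff ℝ 1 U := hUs.of_le (by norm_cast)
  have hWs : ContDiff ℝ ∞ W := by rw [hWdef]; exact (hu.smooth_velocity.timeDerivWithin hS).contDiff_slice ht
  have hW1 : ContDiff ℝ 1 W := hWs.of_le (by norm_cast)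
  have hPs : ContDiff ℝ ∞ P := by rw [hPdef]; exact hu.contDiff_pressure ht
  have hP2 : ContDiff ℝ 2 P := hPs.of_le (by norm_cast)
  have hDUs : ContDiff ℝ ∞ (fderiv ℝ U) := hUs.fderiv_right (m := ∞) (by simp)
  have hDPs : ContDiff ℝ ∞ (fderiv ℝ P) := hPs.fderiv_right (m := ∞) (by simp)
  have hN : ContDiff ℝ ∞ (convect U U) := hDUs.clm_apply hUs
  have hN1 : ContDiff ℝ 1 (convect U U) := hN.of_le (by norm_cast)
  have hGs : ContDiff ℝ ∞ (gradient P) := by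
    show ContDiff ℝ ∞
      (fun y => (InnerProductSpace.toDual ℝ (EuclideanSpace ℝ (Fin 3))).symm (fderiv ℝ P y))
    exact (InnerProductSpace.toDual ℝ (EuclideanSpace ℝ (Fin 3))).symm.contDiff.comp hDPs
  have hG1 : ContDiff ℝ 1 (gradient P) := hGs.of_le (by norm_cast)
  have hΔ1 : ContDiff ℝ 1 (Δ U) := contDiff_one_laplacian_of_contDiff_three hU3
  -- sup bounds of `U`, `DU`
  obtain ⟨B, hB⟩ := linfty_bound_of_hasBoundedSobolevNormsOn_holds
    (fun s hs => (hu.contDiff_velocity hs).of_le (by norm_cast)) hU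
  obtain ⟨B₁, hB₁0, hB₁⟩ := exists_forall_norm_fderiv_le_of_hasBoundedSobolevNormsOn
    (fun s hs => (hu.contDiff_velocity hs).of_le (by norm_cast)) hU
  have hB0 : 0 ≤ B := (norm_nonneg _).trans (hB t ht 0)
  have hBU : ∀ x, ‖U x‖ ≤ B := fun x => by rw [hUdef]; exact hB t ht x
  have hB₁U : ∀ x, ‖fderiv ℝ U x‖ ≤ B₁ := fun x => by rw [hUdef]; exact hB₁ t ht x
  -- the equation `f = ∂ₜu + (u·∇)u + ∇p − νΔu` and its derivative
  have hf_eq : f t = fun x => W x + convect U U x + gradient P x - ν • (Δ U) x := by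
    funext x
    rw [hUdef, hWdef, hPdef, hu.momentum t ht x]
    abel
  have hDf : ∀ x, fderiv ℝ (f t) x =
      fderiv ℝ W x + fderiv ℝ (convect U U) x + fderiv ℝ (gradient P) x - ν • fderiv ℝ (Δ U) x := by
    intro x
    have dW := ((hW1.differentiable one_ne_zero) x).hasFDerivAt
    have dN := ((hN1.differentiable one_ne_zero) x).hasFDerivAt
    have dG := ((hG1.differentiable one_ne_zero) x).hasFDerivAt
    have dΔ := ((hΔ1.differentiable one_ne_zero) x).hasFDerivAt
    rw [hf_eq]
    exact (((dW.add dN).add dG).sub (dΔ.const_smul ν)).fderiv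
  -- norms as iterated derivatives
  have nD : ∀ {F' : Type} [NormedAddCommGroup F'] [NormedSpace ℝ F']
      (z : EuclideanSpace ℝ (Fin 3) → F') (x : EuclideanSpace ℝ (Fin 3)),
      ‖fderiv ℝ z x‖ = ‖iteratedFDeriv ℝ 1 z x‖ := fun z x => by
    rw [← norm_iteratedFDeriv_fderiv, norm_iteratedFDeriv_zero]
  have e23 : ∀ x, ‖iteratedFDeriv ℝ 2 (fderiv ℝ U) x‖ = ‖iteratedFDeriv ℝ 3 U x‖ := fun x =>
    norm_iteratedFDeriv_fderiv
  have e12 : ∀ x, ‖iteratedFDeriv ℝ 1 (fderiv ℝ U) x‖ = ‖iteratedFDeriv ℝ 2 U x‖ := fun x =>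
    norm_iteratedFDeriv_fderiv
  have e12P : ∀ x, ‖iteratedFDeriv ℝ 1 (fderiv ℝ P) x‖ = ‖iteratedFDeriv ℝ 2 P x‖ := fun x =>
    norm_iteratedFDeriv_fderiv
  -- pointwise bounds of the four pieces
  have nΔ : ∀ x, ‖fderiv ℝ (Δ U) x‖ ≤ ‖(3 : ℝ) • iteratedFDeriv ℝ 3 U x‖ := by
    intro x
    rw [norm_smul, Real.norm_of_nonneg (by norm_num : (0 : ℝ) ≤ 3)]
    refine ContinuousLinearMap.opNorm_le_bound _ (by positivity) fun a => ?_
    rw [fderiv_laplacian_apply_of_contDiff_three hU3 x a]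
    have h2 : ContDiff ℝ 2 (fun y => fderiv ℝ U y a) :=
      (hDUs.clm_apply contDiff_const).of_le (by norm_cast)
    calc ‖(Δ (fun y => fderiv ℝ U y a)) x‖
        ≤ 3 * ‖iteratedFDeriv ℝ 2 (fun y => fderiv ℝ U y a) x‖ :=
          norm_laplacian_le_three_mul_norm_iteratedFDeriv_two h2 x
      _ ≤ 3 * (‖a‖ * ‖iteratedFDeriv ℝ 2 (fderiv ℝ U) x‖) := by
          gcongr
          exact norm_iteratedFDeriv_clm_apply_const hDUs.contDiffAt (by norm_cast)
      _ = 3 * ‖iteratedFDeriv ℝ 3 U x‖ * ‖a‖ := by rw [e23]; ring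
  have nG : ∀ x, ‖fderiv ℝ (gradient P) x‖ ≤ ‖iteratedFDeriv ℝ 2 P x‖ := by
    intro x
    refine ContinuousLinearMap.opNorm_le_bound _ (norm_nonneg _) fun a => ?_
    rw [r3rob_fderiv_gradient_apply hP2 x a, gradient, LinearIsometryEquiv.norm_map,
      nD (fun y => fderiv ℝ P y a) x]
    calc ‖iteratedFDeriv ℝ 1 (fun y => fderiv ℝ P y a) x‖
        ≤ ‖a‖ * ‖iteratedFDeriv ℝ 1 (fderiv ℝ P) x‖ :=
          norm_iteratedFDeriv_clm_apply_const hDPs.contDiffAt (by norm_cast)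
      _ = ‖iteratedFDeriv ℝ 2 P x‖ * ‖a‖ := by rw [e12P]; ring
  have nN : ∀ x, ‖fderiv ℝ (convect U U) x‖ ≤
      ‖B * ‖iteratedFDeriv ℝ 2 U x‖ + B₁ * ‖fderiv ℝ U x‖‖ := by
    intro x
    rw [Real.norm_of_nonneg (by positivity)]
    refine ContinuousLinearMap.opNorm_le_bound _ (by positivity) fun a => ?_
    rw [fderiv_convect_apply_of_contDiff hUs hUs x a]
    have h1 : ‖fderiv ℝ U x (fderiv ℝ U x a)‖ ≤ B₁ * ‖fderiv ℝ U x‖ * ‖a‖ :=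
      calc ‖fderiv ℝ U x (fderiv ℝ U x a)‖ ≤ ‖fderiv ℝ U x‖ * ‖fderiv ℝ U x a‖ :=
            ContinuousLinearMap.le_opNorm _ _
        _ ≤ ‖fderiv ℝ U x‖ * (‖fderiv ℝ U x‖ * ‖a‖) := by
            gcongr; exact ContinuousLinearMap.le_opNorm _ _
        _ ≤ B₁ * (‖fderiv ℝ U x‖ * ‖a‖) := by
            rw [mul_comm ‖fderiv ℝ U x‖ (‖fderiv ℝ U x‖ * ‖a‖), mul_assoc, mul_comm ‖a‖]
            exact mul_le_mul_of_nonneg_right (hB₁U x) (by positivity)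
        _ = B₁ * ‖fderiv ℝ U x‖ * ‖a‖ := by ring
    have h2 : ‖convect U (fun y => fderiv ℝ U y a) x‖ ≤ B * ‖iteratedFDeriv ℝ 2 U x‖ * ‖a‖ := by
      rw [convect]
      calc ‖fderiv ℝ (fun y => fderiv ℝ U y a) x (U x)‖
          ≤ ‖fderiv ℝ (fun y => fderiv ℝ U y a) x‖ * ‖U x‖ := ContinuousLinearMap.le_opNorm _ _
        _ ≤ (‖a‖ * ‖iteratedFDeriv ℝ 2 U x‖) * B := by
            refine mul_le_mul ?_ (hBU x) (norm_nonneg _) (by positivity)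
            rw [nD (fun y => fderiv ℝ U y a) x, ← e12]
            exact norm_iteratedFDeriv_clm_apply_const hDUs.contDiffAt (by norm_cast)
        _ = B * ‖iteratedFDeriv ℝ 2 U x‖ * ‖a‖ := by ring
    calc ‖fderiv ℝ U x (fderiv ℝ U x a) + convect U (fun y => fderiv ℝ U y a) x‖
        ≤ ‖fderiv ℝ U x (fderiv ℝ U x a)‖ + ‖convect U (fun y => fderiv ℝ U y a) x‖ :=
          norm_add_le _ _
      _ ≤ (B * ‖iteratedFDeriv ℝ 2 U x‖ + B₁ * ‖fderiv ℝ U x‖) * ‖a‖ := by linarith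
  -- the four pieces in `L²`
  have hW1' : ∫⁻ x, ‖iteratedFDeriv ℝ 1 W x‖ₑ ^ 2 < ⊤ := by
    rw [hWdef]; exact r3rob_fin ht 1 (hUt 1)
  have l2W : ∫⁻ x, ‖fderiv ℝ W x‖ₑ ^ 2 < ⊤ :=
    lintegral_enorm_sq_lt_top_of_norm_le (fun x => (nD W x).le) hW1'
  have hU3' : ∫⁻ x, ‖iteratedFDeriv ℝ 3 U x‖ₑ ^ 2 < ⊤ := by
    rw [hUdef]; exact r3rob_fin ht 3 (hU 3)
  have hP2' : ∫⁻ x, ‖iteratedFDeriv ℝ 2 P x‖ₑ ^ 2 < ⊤ := by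
    rw [hPdef]; exact r3rob_fin ht 2 (hp 2)
  have l2Δ : ∫⁻ x, ‖fderiv ℝ (Δ U) x‖ₑ ^ 2 < ⊤ :=
    lintegral_enorm_sq_lt_top_of_norm_le nΔ (r3rob_lintegral_sq_smul_lt_top 3 hU3')
  have l2G : ∫⁻ x, ‖fderiv ℝ (gradient P) x‖ₑ ^ 2 < ⊤ :=
    lintegral_enorm_sq_lt_top_of_norm_le nG hP2'
  have hU1' : ∫⁻ x, ‖iteratedFDeriv ℝ 1 U x‖ₑ ^ 2 < ⊤ := by
    rw [hUdef]; exact r3rob_fin ht 1 (hU 1)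
  have l2U1 : ∫⁻ x, ‖fderiv ℝ U x‖ₑ ^ 2 < ⊤ :=
    lintegral_enorm_sq_lt_top_of_norm_le (fun x => (nD U x).le) hU1'
  have l2U2 : ∫⁻ x, ‖iteratedFDeriv ℝ 2 U x‖ₑ ^ 2 < ⊤ := by rw [hUdef]; exact r3rob_fin ht 2 (hU 2)
  have cU2 : Continuous fun x => B * ‖iteratedFDeriv ℝ 2 U x‖ :=
    continuous_const.mul (hUs.continuous_iteratedFDeriv (by norm_cast)).norm
  have l2N : ∫⁻ x, ‖fderiv ℝ (convect U U) x‖ₑ ^ 2 < ⊤ :=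
    lintegral_enorm_sq_lt_top_of_norm_le nN
      (r3rob_lintegral_sq_add_lt_top cU2.aestronglyMeasurable
        (r3rob_lintegral_sq_mul_norm_lt_top B l2U2) (r3rob_lintegral_sq_mul_norm_lt_top B₁ l2U1))
  -- assemble
  have cW : Continuous (fderiv ℝ W) := hW1.continuous_fderiv one_ne_zero
  have cN : Continuous (fderiv ℝ (convect U U)) := hN1.continuous_fderiv one_ne_zero
  have cG : Continuous (fderiv ℝ (gradient P)) := hG1.continuous_fderiv one_ne_zero
  have h1 := r3rob_lintegral_sq_add_lt_top cW.aestronglyMeasurable l2W l2N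
  have h2 := r3rob_lintegral_sq_add_lt_top (cW.add cN).aestronglyMeasurable h1 l2G
  have h3 := r3rob_lintegral_sq_sub_lt_top ((cW.add cN).add cG).aestronglyMeasurable h2
    (r3rob_lintegral_sq_smul_lt_top ν l2Δ)
  refine lt_of_le_of_lt (le_of_eq (lintegral_congr fun x => ?_)) h3
  rw [hDf x]
  simp only [Pi.add_apply]

end ForceDerivative

/-! ## §C Window form with majorants of the two defects (the literal certificate shape) -/

section WindowH2Majorants

variable {ν t₀ t₁ : ℝ} {f g u v : ℝ → EuclideanSpace ℝ (Fin 3) → EuclideanSpace ℝ (Fin 3)}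
variable {p q : ℝ → EuclideanSpace ℝ (Fin 3) → ℝ}

/-- Monotonicity of the Riccati comparison bound `e^{E}η/(1 − cηs)` in `η`. [folklore] -/
private theorem r3rob_riccati_bound_mono {c η η' s E : ℝ} (hc : 0 ≤ c) (hη : 0 ≤ η) (hηη' : η ≤ η')
    (hs : 0 ≤ s) (hpos : 0 < 1 - c * η' * s) :
    Real.exp E * η / (1 - c * η * s) ≤ Real.exp E * η' / (1 - c * η' * s) := by
  have hden : 1 - c * η' * s ≤ 1 - c * η * s := by
    have := mul_le_mul_of_nonneg_right (mul_le_mul_of_nonneg_left hηη' hc) hs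
    linarith
  have hpos' : 0 < 1 - c * η * s := hpos.trans_le hden
  have hE := Real.exp_pos E
  calc Real.exp E * η / (1 - c * η * s)
      ≤ Real.exp E * η' / (1 - c * η * s) :=
        div_le_div_of_nonneg_right (mul_le_mul_of_nonneg_left hηη' hE.le) hpos'.le
    _ ≤ Real.exp E * η' / (1 - c * η' * s) :=
        div_le_div_of_nonneg_left (mul_nonneg hE.le (hη.trans hηη')) hpos hden

/-- **Window form of the `H²` strain theorem with MAJORANTS of the two defects** (the literal
certificate shape): in the setting of `classicalNS_robustness_H2_strain_window_R3`, if
`Z(t₀) ≤ D₂` (datum defect at the `H²` level) and `∫_{t₀}^{t₁} ψ ≤ Ψ₂` (accumulated source),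
`η' = D₂ + Ψ₂`, `Λ(t) = ∫_{t₀}^{t} l`, `β = A²μ/ν`, and `βe^{Λ(t₁)}η'(t₁ − t₀) < 1`, then
`Z(t) ≤ e^{Λ(t)}η'/(1 − βe^{Λ(t₁)}η'(t − t₀))` on `[t₀, t₁]` (the bound is monotone in `η`).
[cite: DashtiRobinson2008, Thm 2 (proof) and Lemma 1] -/
theorem classicalNS_robustness_H2_strain_window_of_le_R3 (hν : 0 < ν) (ht₀₁ : t₀ < t₁)
    (hv : IsClassicalNSSolutionOn (Icc t₀ t₁) ν g v q)
    (hu : IsClassicalNSSolutionOn (Icc t₀ t₁) ν f u p)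
    (hU : HasBoundedSobolevNormsOn (Icc t₀ t₁) u)
    (hUt : HasBoundedSobolevNormsOn (Icc t₀ t₁) (timeDerivWithin (Icc t₀ t₁) u))
    (hp : ∀ n : ℕ, ∃ C : ℝ≥0, ∀ t ∈ Icc t₀ t₁, ∫⁻ x, ‖iteratedFDeriv ℝ n (p t) x‖ₑ ^ 2 ≤ C)
    (hV : HasBoundedSobolevNormsOn (Icc t₀ t₁) v)
    (hVt : HasBoundedSobolevNormsOn (Icc t₀ t₁) (timeDerivWithin (Icc t₀ t₁) v))
    (hq : ∀ n : ℕ, ∃ C : ℝ≥0, ∀ t ∈ Icc t₀ t₁, ∫⁻ x, ‖iteratedFDeriv ℝ n (q t) x‖ₑ ^ 2 ≤ C)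
    (hfD : ∀ t ∈ Icc t₀ t₁, ∫⁻ x, ‖fderiv ℝ (f t) x‖ₑ ^ 2 < ⊤)
    (hgD : ∀ t ∈ Icc t₀ t₁, ∫⁻ x, ‖fderiv ℝ (g t) x‖ₑ ^ 2 < ⊤)
    {G σ₂ σ₃ L X₁ H₁ ψ : ℝ → ℝ} {κ μ D₂ Ψ₂ : ℝ} (hκ : 0 < κ) (hμ : 0 < μ)
    (hG : ∀ s ∈ Icc t₀ t₁, ∀ (x ξ : EuclideanSpace ℝ (Fin 3)),
      -⟪fderiv ℝ (u s) x ξ, ξ⟫ ≤ G s * ‖ξ‖ ^ 2)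
    (hσ₂ : ∀ s ∈ Icc t₀ t₁, ∀ x, ‖iteratedFDeriv ℝ 2 (u s) x‖ ≤ σ₂ s)
    (hσ₃ : ∀ s ∈ Icc t₀ t₁, ∀ x, ‖iteratedFDeriv ℝ 3 (u s) x‖ ≤ σ₃ s)
    (hL : ∀ s ∈ Icc t₀ t₁, Real.sqrt (∫ x, ‖(v - u) s x‖ ^ 2) ≤ L s)
    (hX₁ : ∀ s ∈ Icc t₀ t₁, ∫ x, frobeniusNormSq (fderiv ℝ ((v - u) s) x) ≤ X₁ s)
    (hH₁ : ∀ s ∈ Icc t₀ t₁, ∫ x, ‖fderiv ℝ (fun y => f s y - g s y) x‖ ^ 2 ≤ H₁ s)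
    (hψ : ∀ s ∈ Icc t₀ t₁,
      27 * σ₂ s / κ * X₁ s + 9 * σ₃ s / κ ^ 2 * L s ^ 2 + 6 / ν * H₁ s ≤ ψ s)
    (hGc : ContinuousOn G (Icc t₀ t₁)) (hσ₂c : ContinuousOn σ₂ (Icc t₀ t₁))
    (hσ₃c : ContinuousOn σ₃ (Icc t₀ t₁)) (hLc : ContinuousOn L (Icc t₀ t₁))
    (hX₁c : ContinuousOn X₁ (Icc t₀ t₁)) (hH₁c : ContinuousOn H₁ (Icc t₀ t₁))
    (hψc : ContinuousOn ψ (Icc t₀ t₁))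
    (hD₂ : (∑ i, ∫ x, frobeniusNormSq (fderiv ℝ (fun y => fderiv ℝ ((v - u) t₀) y
      (EuclideanSpace.basisFun (Fin 3) ℝ i)) x)) ≤ D₂)
    (hΨ₂ : ∫ s in t₀..t₁, ψ s ≤ Ψ₂)
    (hsmall : agmonConst ^ 2 * μ / ν *
        Real.exp (∫ s in t₀..t₁, (6 * G s + 9 * κ * σ₂ s + 3 * κ ^ 2 * σ₃ s +
          3 * agmonConst ^ 2 * X₁ s / (ν * μ) + 27 * agmonConst ^ 4 * X₁ s ^ 2 / (16 * ν ^ 3))) *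
      (D₂ + Ψ₂) * (t₁ - t₀) < 1)
    {t : ℝ} (ht : t ∈ Icc t₀ t₁) :
    (∑ i, ∫ x, frobeniusNormSq (fderiv ℝ (fun y => fderiv ℝ ((v - u) t) y
        (EuclideanSpace.basisFun (Fin 3) ℝ i)) x)) ≤
      Real.exp (∫ s in t₀..t, (6 * G s + 9 * κ * σ₂ s + 3 * κ ^ 2 * σ₃ s +
          3 * agmonConst ^ 2 * X₁ s / (ν * μ) + 27 * agmonConst ^ 4 * X₁ s ^ 2 / (16 * ν ^ 3))) *
          (D₂ + Ψ₂) /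
        (1 - agmonConst ^ 2 * μ / ν *
          Real.exp (∫ s in t₀..t₁, (6 * G s + 9 * κ * σ₂ s + 3 * κ ^ 2 * σ₃ s +
            3 * agmonConst ^ 2 * X₁ s / (ν * μ) + 27 * agmonConst ^ 4 * X₁ s ^ 2 / (16 * ν ^ 3))) *
          (D₂ + Ψ₂) * (t - t₀)) := by
  -- abbreviations
  obtain ⟨c, hc⟩ : ∃ c : ℝ, c = agmonConst ^ 2 * μ / ν *
      Real.exp (∫ s in t₀..t₁, (6 * G s + 9 * κ * σ₂ s + 3 * κ ^ 2 * σ₃ s +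
        3 * agmonConst ^ 2 * X₁ s / (ν * μ) + 27 * agmonConst ^ 4 * X₁ s ^ 2 / (16 * ν ^ 3))) :=
    ⟨_, rfl⟩
  obtain ⟨η, hη⟩ : ∃ η : ℝ, η = (∑ i, ∫ x, frobeniusNormSq (fderiv ℝ (fun y => fderiv ℝ ((v - u) t₀) y
      (EuclideanSpace.basisFun (Fin 3) ℝ i)) x)) + ∫ s in t₀..t₁, ψ s := ⟨_, rfl⟩
  have hc0 : 0 ≤ c := by
    rw [hc]
    have := agmonConst_nonneg
    positivity
  have hZ0 : 0 ≤ ∑ i, ∫ x, frobeniusNormSq (fderiv ℝ (fun y => fderiv ℝ ((v - u) t₀) y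
      (EuclideanSpace.basisFun (Fin 3) ℝ i)) x) :=
    Finset.sum_nonneg fun i _ => integral_nonneg fun x => frobeniusNormSq_nonneg _
  have hσ₂0 : ∀ s ∈ Icc t₀ t₁, 0 ≤ σ₂ s := fun s hs => (norm_nonneg _).trans (hσ₂ s hs 0)
  have hσ₃0 : ∀ s ∈ Icc t₀ t₁, 0 ≤ σ₃ s := fun s hs => (norm_nonneg _).trans (hσ₃ s hs 0)
  have hX₁0 : ∀ s ∈ Icc t₀ t₁, 0 ≤ X₁ s := fun s hs =>
    (integral_nonneg fun x => frobeniusNormSq_nonneg _).trans (hX₁ s hs)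
  have hH₁0 : ∀ s ∈ Icc t₀ t₁, 0 ≤ H₁ s := fun s hs =>
    (integral_nonneg fun x => sq_nonneg _).trans (hH₁ s hs)
  have hψ0 : ∀ s ∈ Icc t₀ t₁, 0 ≤ ψ s := fun s hs => by
    refine le_trans ?_ (hψ s hs)
    have := hσ₂0 s hs; have := hσ₃0 s hs; have := hX₁0 s hs; have := hH₁0 s hs
    positivity
  have hΨ0 : 0 ≤ ∫ s in t₀..t₁, ψ s := intervalIntegral.integral_nonneg ht₀₁.le hψ0
  have hη0 : 0 ≤ η := by rw [hη]; exact add_nonneg hZ0 hΨ0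
  have hηη' : η ≤ D₂ + Ψ₂ := by rw [hη]; exact add_le_add hD₂ hΨ₂
  have hT0 : 0 ≤ t₁ - t₀ := sub_nonneg.2 ht₀₁.le
  -- the smallness condition for the exact `η`
  have hsmall' : c * η * (t₁ - t₀) < 1 := by
    have h1 : c * η * (t₁ - t₀) ≤ c * (D₂ + Ψ₂) * (t₁ - t₀) :=
      mul_le_mul_of_nonneg_right (mul_le_mul_of_nonneg_left hηη' hc0) hT0
    have h2 : c * (D₂ + Ψ₂) * (t₁ - t₀) < 1 := by rw [hc]; exact hsmall
    linarith
  have key := classicalNS_robustness_H2_strain_window_R3 hν ht₀₁ hv hu hU hUt hp hV hVt hq hfD hgD hκ hμ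
    hG hσ₂ hσ₃ hL hX₁ hH₁ hψ hGc hσ₂c hσ₃c hLc hX₁c hH₁c hψc (by rw [← hc, ← hη]; exact hsmall') ht
  rw [← hc, ← hη] at key
  rw [← hc]
  refine key.trans ?_
  have hpos : 0 < 1 - c * (D₂ + Ψ₂) * (t - t₀) := by
    have h1 : c * (D₂ + Ψ₂) * (t - t₀) ≤ c * (D₂ + Ψ₂) * (t₁ - t₀) :=
      mul_le_mul_of_nonneg_left (sub_le_sub_right ht.2 _) (mul_nonneg hc0 (hη0.trans hηη'))
    have h2 : c * (D₂ + Ψ₂) * (t₁ - t₀) < 1 := by rw [hc]; exact hsmall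
    linarith
  exact r3rob_riccati_bound_mono hc0 hη0 hηη' (sub_nonneg.2 ht.1) hpos

end WindowH2Majorants


/-! ## §D The packaged sup-norm distance on a window from the `H¹` and `H²` certificates -/

section SupDoor

variable {ν t₀ t₁ : ℝ} {f g u v : ℝ → EuclideanSpace ℝ (Fin 3) → EuclideanSpace ℝ (Fin 3)}
variable {p q : ℝ → EuclideanSpace ℝ (Fin 3) → ℝ}

/-- **Sup-norm distance of two classical solutions on a window from the strain-currency
certificates (a priori; RRS 2016 Thm 9.1 / Dashti–Robinson 2008 Thms 1–2 in strain form, read out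
by Agmon).** Let `(u, p)` (force `f`, the reference) and `(v, q)` (force `g`) be classical
solutions on `[t₀, t₁] × ℝ³` in the `L²`-Sobolev class with `Df, Dg ∈ L²` slicewise, and let
continuous majorants on `[t₀, t₁]` be given: `G` (compression rate of `Du`), `σ₂ ≥ ‖D²u‖_∞`,
`σ₃ ≥ ‖D³u‖_∞`, `L ≥ ‖(v − u)(s)‖_{L²}`, `X₁` and `H₁ ≥ ∫‖D(f − g)(s)‖²`, sources
`ψ₁ ≥ (2/ν)‖f − g‖²_{L²} + 3σ₂L²/κ`, `ψ₂ ≥ 27σ₂X₁/κ + 9σ₃L²/κ² + 6H₁/ν`, defects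
`D₁ ≥ ∫|∇(v − u)(t₀)|²_F`, `Ψ₁ ≥ ∫ψ₁`, `D₂ ≥ Z(t₀)`, `Ψ₂ ≥ ∫ψ₂`, where `X₁` dominates the `H¹`
certificate bound: `e^{Λ₁(s)}(D₁ + Ψ₁)/√(1 − 2β₁e^{2Λ₁(t₁)}(D₁ + Ψ₁)²(s − t₀)) ≤ X₁(s)`
(`Λ₁ = ∫(4G + 3κσ₂)`, `β₁ = A⁴/(2ν³)`). If both smallness conditions hold
(`2β₁e^{2Λ₁(t₁)}(D₁ + Ψ₁)²(t₁ − t₀) < 1`, `β₂e^{Λ₂(t₁)}(D₂ + Ψ₂)(t₁ − t₀) < 1`,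
`Λ₂ = ∫(6G + 9κσ₂ + 3κ²σ₃ + 3A²X₁/(νμ) + 27A⁴X₁²/(16ν³))`, `β₂ = A²μ/ν`), then for
`t ∈ [t₀, t₁]` and every `x`:
`‖v(t,x) − u(t,x)‖ ≤ A·(3·X₁(t)·e^{Λ₂(t)}(D₂ + Ψ₂)/(1 − β₂e^{Λ₂(t₁)}(D₂ + Ψ₂)(t − t₀)))^{1/4}`.
[cite: RobinsonRodrigoSadowskiCUP2016, Thm 9.1 and Thm 1.20; DashtiRobinson2008, Thm 1, Thm 2] -/
theorem classicalNS_norm_sub_le_strain_window_R3 (hν : 0 < ν) (ht₀₁ : t₀ < t₁)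
    (hv : IsClassicalNSSolutionOn (Icc t₀ t₁) ν g v q)
    (hu : IsClassicalNSSolutionOn (Icc t₀ t₁) ν f u p)
    (hU : HasBoundedSobolevNormsOn (Icc t₀ t₁) u)
    (hUt : HasBoundedSobolevNormsOn (Icc t₀ t₁) (timeDerivWithin (Icc t₀ t₁) u))
    (hp : ∀ n : ℕ, ∃ C : ℝ≥0, ∀ t ∈ Icc t₀ t₁, ∫⁻ x, ‖iteratedFDeriv ℝ n (p t) x‖ₑ ^ 2 ≤ C)
    (hV : HasBoundedSobolevNormsOn (Icc t₀ t₁) v)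
    (hVt : HasBoundedSobolevNormsOn (Icc t₀ t₁) (timeDerivWithin (Icc t₀ t₁) v))
    (hq : ∀ n : ℕ, ∃ C : ℝ≥0, ∀ t ∈ Icc t₀ t₁, ∫⁻ x, ‖iteratedFDeriv ℝ n (q t) x‖ₑ ^ 2 ≤ C)
    (hfD : ∀ t ∈ Icc t₀ t₁, ∫⁻ x, ‖fderiv ℝ (f t) x‖ₑ ^ 2 < ⊤)
    (hgD : ∀ t ∈ Icc t₀ t₁, ∫⁻ x, ‖fderiv ℝ (g t) x‖ₑ ^ 2 < ⊤)
    {G σ₂ σ₃ L X₁ H₁ ψ₁ ψ₂ : ℝ → ℝ} {κ μ D₁ Ψ₁ D₂ Ψ₂ : ℝ} (hκ : 0 < κ) (hμ : 0 < μ)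
    (hG : ∀ s ∈ Icc t₀ t₁, ∀ (x ξ : EuclideanSpace ℝ (Fin 3)),
      -⟪fderiv ℝ (u s) x ξ, ξ⟫ ≤ G s * ‖ξ‖ ^ 2)
    (hσ₂ : ∀ s ∈ Icc t₀ t₁, ∀ x, ‖iteratedFDeriv ℝ 2 (u s) x‖ ≤ σ₂ s)
    (hσ₃ : ∀ s ∈ Icc t₀ t₁, ∀ x, ‖iteratedFDeriv ℝ 3 (u s) x‖ ≤ σ₃ s)
    (hL : ∀ s ∈ Icc t₀ t₁, Real.sqrt (∫ x, ‖(v - u) s x‖ ^ 2) ≤ L s)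
    (hH₁ : ∀ s ∈ Icc t₀ t₁, ∫ x, ‖fderiv ℝ (fun y => f s y - g s y) x‖ ^ 2 ≤ H₁ s)
    (hψ₁ : ∀ s ∈ Icc t₀ t₁, 2 / ν * (∫ x, ‖f s x - g s x‖ ^ 2) + 3 * σ₂ s / κ * L s ^ 2 ≤ ψ₁ s)
    (hψ₂ : ∀ s ∈ Icc t₀ t₁,
      27 * σ₂ s / κ * X₁ s + 9 * σ₃ s / κ ^ 2 * L s ^ 2 + 6 / ν * H₁ s ≤ ψ₂ s)
    (hGc : ContinuousOn G (Icc t₀ t₁)) (hσ₂c : ContinuousOn σ₂ (Icc t₀ t₁))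
    (hσ₃c : ContinuousOn σ₃ (Icc t₀ t₁)) (hLc : ContinuousOn L (Icc t₀ t₁))
    (hX₁c : ContinuousOn X₁ (Icc t₀ t₁)) (hH₁c : ContinuousOn H₁ (Icc t₀ t₁))
    (hψ₁c : ContinuousOn ψ₁ (Icc t₀ t₁)) (hψ₂c : ContinuousOn ψ₂ (Icc t₀ t₁))
    (hD₁ : ∫ x, frobeniusNormSq (fderiv ℝ ((v - u) t₀) x) ≤ D₁)
    (hΨ₁ : ∫ s in t₀..t₁, ψ₁ s ≤ Ψ₁)
    (hD₂ : (∑ i, ∫ x, frobeniusNormSq (fderiv ℝ (fun y => fderiv ℝ ((v - u) t₀) y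
      (EuclideanSpace.basisFun (Fin 3) ℝ i)) x)) ≤ D₂)
    (hΨ₂ : ∫ s in t₀..t₁, ψ₂ s ≤ Ψ₂)
    (hsmall₁ : 2 * (agmonConst ^ 4 / (2 * ν ^ 3) *
        Real.exp (2 * ∫ s in t₀..t₁, (4 * G s + 3 * κ * σ₂ s))) * (D₁ + Ψ₁) ^ 2 * (t₁ - t₀) < 1)
    (hX₁ : ∀ s ∈ Icc t₀ t₁,
      Real.exp (∫ r in t₀..s, (4 * G r + 3 * κ * σ₂ r)) * (D₁ + Ψ₁) /
        Real.sqrt (1 - 2 * (agmonConst ^ 4 / (2 * ν ^ 3) *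
            Real.exp (2 * ∫ r in t₀..t₁, (4 * G r + 3 * κ * σ₂ r))) * (D₁ + Ψ₁) ^ 2 * (s - t₀)) ≤
        X₁ s)
    (hsmall₂ : agmonConst ^ 2 * μ / ν *
        Real.exp (∫ s in t₀..t₁, (6 * G s + 9 * κ * σ₂ s + 3 * κ ^ 2 * σ₃ s +
          3 * agmonConst ^ 2 * X₁ s / (ν * μ) + 27 * agmonConst ^ 4 * X₁ s ^ 2 / (16 * ν ^ 3))) *
      (D₂ + Ψ₂) * (t₁ - t₀) < 1)
    {t : ℝ} (ht : t ∈ Icc t₀ t₁) (x : EuclideanSpace ℝ (Fin 3)) :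
    ‖v t x - u t x‖ ≤ agmonConst * (3 * X₁ t *
      (Real.exp (∫ s in t₀..t, (6 * G s + 9 * κ * σ₂ s + 3 * κ ^ 2 * σ₃ s +
          3 * agmonConst ^ 2 * X₁ s / (ν * μ) + 27 * agmonConst ^ 4 * X₁ s ^ 2 / (16 * ν ^ 3))) *
          (D₂ + Ψ₂) /
        (1 - agmonConst ^ 2 * μ / ν *
          Real.exp (∫ s in t₀..t₁, (6 * G s + 9 * κ * σ₂ s + 3 * κ ^ 2 * σ₃ s +
            3 * agmonConst ^ 2 * X₁ s / (ν * μ) + 27 * agmonConst ^ 4 * X₁ s ^ 2 / (16 * ν ^ 3))) *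
          (D₂ + Ψ₂) * (t - t₀)))) ^ (1 / 4 : ℝ) := by
  -- the `H¹` level along the window, dominated by `X₁`
  have hH1 : ∀ s ∈ Icc t₀ t₁, ∫ x, frobeniusNormSq (fderiv ℝ ((v - u) s) x) ≤ X₁ s := fun s hs =>
    (classicalNS_robustness_strain_window_of_le_R3 hν ht₀₁ hv hu hU hUt hp hV hVt hq hκ hG hσ₂ hL hψ₁
      hGc hσ₂c hψ₁c hD₁ hΨ₁ hsmall₁ hs).trans (hX₁ s hs)
  -- the `H²` level at `t`
  have hH2 := classicalNS_robustness_H2_strain_window_of_le_R3 hν ht₀₁ hv hu hU hUt hp hV hVt hq hfD hgD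
    hκ hμ hG hσ₂ hσ₃ hL hH1 hH₁ hψ₂ hGc hσ₂c hσ₃c hLc hX₁c hH₁c hψ₂c hD₂ hΨ₂ hsmall₂ ht
  -- the readout
  have hwsm : IsSmoothSpaceTimeOn (Icc t₀ t₁) (v - u) := hv.smooth_velocity.sub hu.smooth_velocity
  have hwsob : HasBoundedSobolevNormsOn (Icc t₀ t₁) (v - u) :=
    r3rob_sobolev_sub (fun s _ x => rfl) (fun s hs => hv.contDiff_velocity hs)
      (fun s hs => hu.contDiff_velocity hs) hV hU
  have h := norm_le_agmonConst_mul_rpow_of_le (hwsm.contDiff_slice ht) (r3rob_fin ht 0 (hwsob 0))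
    (r3rob_fin ht 1 (hwsob 1)) (r3rob_fin ht 2 (hwsob 2)) (r3rob_fin ht 3 (hwsob 3)) (hH1 t ht) hH2 x
  simpa only [Pi.sub_apply] using h

end SupDoor

/-! ## §E The packaged door under half-smallness: closed-form sup bound -/

section SupDoorSimple

variable {ν t₀ t₁ : ℝ} {f g u v : ℝ → EuclideanSpace ℝ (Fin 3) → EuclideanSpace ℝ (Fin 3)}
variable {p q : ℝ → EuclideanSpace ℝ (Fin 3) → ℝ}

/-- **The packaged sup-norm door with HALF-smallness, closed form** (the readable price): in the
setting of `classicalNS_norm_sub_le_strain_window_R3`, if the two smallness products are at most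
`1/2` (`2β₁e^{2Λ₁(t₁)}(D₁ + Ψ₁)²(t₁ − t₀) ≤ 1/2`, `β₂e^{Λ₂(t₁)}(D₂ + Ψ₂)(t₁ − t₀) ≤ 1/2`) and the
continuous `X₁` dominates `√2·e^{Λ₁(s)}(D₁ + Ψ₁)` on `[t₀, t₁]`, then for `t ∈ [t₀, t₁]` and
every `x`: `‖v(t,x) − u(t,x)‖ ≤ A(3X₁(t)·2e^{Λ₂(t)}(D₂ + Ψ₂))^{1/4}` — i.e. the sup distance is at
most `A·6^{1/4}·(X₁(t)e^{Λ₂(t)}(D₂ + Ψ₂))^{1/4}`, fee `e^{(Λ₁ + Λ₂)/4}` in strain times, defects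
entering through fourth roots. [cite: RobinsonRodrigoSadowskiCUP2016, Thm 9.1 and Thm 1.20; DashtiRobinson2008, Thm 1, Thm 2] -/
theorem classicalNS_norm_sub_le_strain_window_half_R3 (hν : 0 < ν) (ht₀₁ : t₀ < t₁)
    (hv : IsClassicalNSSolutionOn (Icc t₀ t₁) ν g v q)
    (hu : IsClassicalNSSolutionOn (Icc t₀ t₁) ν f u p)
    (hU : HasBoundedSobolevNormsOn (Icc t₀ t₁) u)
    (hUt : HasBoundedSobolevNormsOn (Icc t₀ t₁) (timeDerivWithin (Icc t₀ t₁) u))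
    (hp : ∀ n : ℕ, ∃ C : ℝ≥0, ∀ t ∈ Icc t₀ t₁, ∫⁻ x, ‖iteratedFDeriv ℝ n (p t) x‖ₑ ^ 2 ≤ C)
    (hV : HasBoundedSobolevNormsOn (Icc t₀ t₁) v)
    (hVt : HasBoundedSobolevNormsOn (Icc t₀ t₁) (timeDerivWithin (Icc t₀ t₁) v))
    (hq : ∀ n : ℕ, ∃ C : ℝ≥0, ∀ t ∈ Icc t₀ t₁, ∫⁻ x, ‖iteratedFDeriv ℝ n (q t) x‖ₑ ^ 2 ≤ C)
    (hfD : ∀ t ∈ Icc t₀ t₁, ∫⁻ x, ‖fderiv ℝ (f t) x‖ₑ ^ 2 < ⊤)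
    (hgD : ∀ t ∈ Icc t₀ t₁, ∫⁻ x, ‖fderiv ℝ (g t) x‖ₑ ^ 2 < ⊤)
    {G σ₂ σ₃ L X₁ H₁ ψ₁ ψ₂ : ℝ → ℝ} {κ μ D₁ Ψ₁ D₂ Ψ₂ : ℝ} (hκ : 0 < κ) (hμ : 0 < μ)
    (hG : ∀ s ∈ Icc t₀ t₁, ∀ (x ξ : EuclideanSpace ℝ (Fin 3)),
      -⟪fderiv ℝ (u s) x ξ, ξ⟫ ≤ G s * ‖ξ‖ ^ 2)
    (hσ₂ : ∀ s ∈ Icc t₀ t₁, ∀ x, ‖iteratedFDeriv ℝ 2 (u s) x‖ ≤ σ₂ s)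
    (hσ₃ : ∀ s ∈ Icc t₀ t₁, ∀ x, ‖iteratedFDeriv ℝ 3 (u s) x‖ ≤ σ₃ s)
    (hL : ∀ s ∈ Icc t₀ t₁, Real.sqrt (∫ x, ‖(v - u) s x‖ ^ 2) ≤ L s)
    (hH₁ : ∀ s ∈ Icc t₀ t₁, ∫ x, ‖fderiv ℝ (fun y => f s y - g s y) x‖ ^ 2 ≤ H₁ s)
    (hψ₁ : ∀ s ∈ Icc t₀ t₁, 2 / ν * (∫ x, ‖f s x - g s x‖ ^ 2) + 3 * σ₂ s / κ * L s ^ 2 ≤ ψ₁ s)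
    (hψ₂ : ∀ s ∈ Icc t₀ t₁,
      27 * σ₂ s / κ * X₁ s + 9 * σ₃ s / κ ^ 2 * L s ^ 2 + 6 / ν * H₁ s ≤ ψ₂ s)
    (hGc : ContinuousOn G (Icc t₀ t₁)) (hσ₂c : ContinuousOn σ₂ (Icc t₀ t₁))
    (hσ₃c : ContinuousOn σ₃ (Icc t₀ t₁)) (hLc : ContinuousOn L (Icc t₀ t₁))
    (hX₁c : ContinuousOn X₁ (Icc t₀ t₁)) (hH₁c : ContinuousOn H₁ (Icc t₀ t₁))
    (hψ₁c : ContinuousOn ψ₁ (Icc t₀ t₁)) (hψ₂c : ContinuousOn ψ₂ (Icc t₀ t₁))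
    (hD₁ : ∫ x, frobeniusNormSq (fderiv ℝ ((v - u) t₀) x) ≤ D₁)
    (hΨ₁ : ∫ s in t₀..t₁, ψ₁ s ≤ Ψ₁)
    (hD₂ : (∑ i, ∫ x, frobeniusNormSq (fderiv ℝ (fun y => fderiv ℝ ((v - u) t₀) y
      (EuclideanSpace.basisFun (Fin 3) ℝ i)) x)) ≤ D₂)
    (hΨ₂ : ∫ s in t₀..t₁, ψ₂ s ≤ Ψ₂)
    (hhalf₁ : 2 * (agmonConst ^ 4 / (2 * ν ^ 3) *
        Real.exp (2 * ∫ s in t₀..t₁, (4 * G s + 3 * κ * σ₂ s))) * (D₁ + Ψ₁) ^ 2 * (t₁ - t₀) ≤ 1 / 2)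
    (hX₁ : ∀ s ∈ Icc t₀ t₁,
      Real.sqrt 2 * (Real.exp (∫ r in t₀..s, (4 * G r + 3 * κ * σ₂ r)) * (D₁ + Ψ₁)) ≤ X₁ s)
    (hhalf₂ : agmonConst ^ 2 * μ / ν *
        Real.exp (∫ s in t₀..t₁, (6 * G s + 9 * κ * σ₂ s + 3 * κ ^ 2 * σ₃ s +
          3 * agmonConst ^ 2 * X₁ s / (ν * μ) + 27 * agmonConst ^ 4 * X₁ s ^ 2 / (16 * ν ^ 3))) *
      (D₂ + Ψ₂) * (t₁ - t₀) ≤ 1 / 2)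
    {t : ℝ} (ht : t ∈ Icc t₀ t₁) (x : EuclideanSpace ℝ (Fin 3)) :
    ‖v t x - u t x‖ ≤ agmonConst * (3 * X₁ t *
      (2 * (Real.exp (∫ s in t₀..t, (6 * G s + 9 * κ * σ₂ s + 3 * κ ^ 2 * σ₃ s +
          3 * agmonConst ^ 2 * X₁ s / (ν * μ) + 27 * agmonConst ^ 4 * X₁ s ^ 2 / (16 * ν ^ 3))) *
        (D₂ + Ψ₂)))) ^ (1 / 4 : ℝ) := by
  -- abbreviations
  obtain ⟨c₁, hc₁⟩ : ∃ c₁ : ℝ, c₁ = 2 * (agmonConst ^ 4 / (2 * ν ^ 3) *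
      Real.exp (2 * ∫ s in t₀..t₁, (4 * G s + 3 * κ * σ₂ s))) := ⟨_, rfl⟩
  obtain ⟨c₂, hc₂⟩ : ∃ c₂ : ℝ, c₂ = agmonConst ^ 2 * μ / ν *
      Real.exp (∫ s in t₀..t₁, (6 * G s + 9 * κ * σ₂ s + 3 * κ ^ 2 * σ₃ s +
        3 * agmonConst ^ 2 * X₁ s / (ν * μ) + 27 * agmonConst ^ 4 * X₁ s ^ 2 / (16 * ν ^ 3))) :=
    ⟨_, rfl⟩
  have hA0 : 0 ≤ agmonConst := agmonConst_nonneg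
  have hc₁0 : 0 ≤ c₁ := by rw [hc₁]; positivity
  have hc₂0 : 0 ≤ c₂ := by rw [hc₂]; positivity
  rw [← hc₁] at hhalf₁
  rw [← hc₂] at hhalf₂
  have hT0 : 0 < t₁ - t₀ := sub_pos.2 ht₀₁
  -- signs of the two defect totals
  have hσ₂0 : ∀ s ∈ Icc t₀ t₁, 0 ≤ σ₂ s := fun s hs => (norm_nonneg _).trans (hσ₂ s hs 0)
  have hσ₃0 : ∀ s ∈ Icc t₀ t₁, 0 ≤ σ₃ s := fun s hs => (norm_nonneg _).trans (hσ₃ s hs 0)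
  have hH₁0 : ∀ s ∈ Icc t₀ t₁, 0 ≤ H₁ s := fun s hs =>
    (integral_nonneg fun x => sq_nonneg _).trans (hH₁ s hs)
  have hη₁0 : 0 ≤ D₁ + Ψ₁ := by
    have h1 : 0 ≤ D₁ := (integral_nonneg fun x => frobeniusNormSq_nonneg _).trans hD₁
    have hψ0 : ∀ s ∈ Icc t₀ t₁, 0 ≤ ψ₁ s := fun s hs => by
      refine le_trans ?_ (hψ₁ s hs)
      have : 0 ≤ ∫ x, ‖f s x - g s x‖ ^ 2 := integral_nonneg fun x => sq_nonneg _
      have := hσ₂0 s hs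
      positivity
    have h2 : 0 ≤ Ψ₁ := (intervalIntegral.integral_nonneg ht₀₁.le hψ0).trans hΨ₁
    exact add_nonneg h1 h2
  have hX₁0 : ∀ s ∈ Icc t₀ t₁, 0 ≤ X₁ s := fun s hs =>
    le_trans (by positivity) (hX₁ s hs)
  have hη₂0 : 0 ≤ D₂ + Ψ₂ := by
    have h1 : 0 ≤ D₂ :=
      (Finset.sum_nonneg fun i _ => integral_nonneg fun x => frobeniusNormSq_nonneg _).trans hD₂
    have hψ0 : ∀ s ∈ Icc t₀ t₁, 0 ≤ ψ₂ s := fun s hs => by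
      refine le_trans ?_ (hψ₂ s hs)
      have := hσ₂0 s hs; have := hσ₃0 s hs; have := hX₁0 s hs; have := hH₁0 s hs
      positivity
    have h2 : 0 ≤ Ψ₂ := (intervalIntegral.integral_nonneg ht₀₁.le hψ0).trans hΨ₂
    exact add_nonneg h1 h2
  -- strict smallness and the `X₁` domination of the exact `H¹` bound
  have hsmall₁ : c₁ * (D₁ + Ψ₁) ^ 2 * (t₁ - t₀) < 1 := hhalf₁.trans_lt (by norm_num)
  have hsmall₂ : c₂ * (D₂ + Ψ₂) * (t₁ - t₀) < 1 := hhalf₂.trans_lt (by norm_num)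
  have hdom : ∀ s ∈ Icc t₀ t₁,
      Real.exp (∫ r in t₀..s, (4 * G r + 3 * κ * σ₂ r)) * (D₁ + Ψ₁) /
        Real.sqrt (1 - c₁ * (D₁ + Ψ₁) ^ 2 * (s - t₀)) ≤ X₁ s := by
    intro s hs
    refine le_trans ?_ (hX₁ s hs)
    have hden : 1 / 2 ≤ 1 - c₁ * (D₁ + Ψ₁) ^ 2 * (s - t₀) := by
      have : c₁ * (D₁ + Ψ₁) ^ 2 * (s - t₀) ≤ c₁ * (D₁ + Ψ₁) ^ 2 * (t₁ - t₀) :=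
        mul_le_mul_of_nonneg_left (sub_le_sub_right hs.2 _) (by positivity)
      linarith
    have hsq : Real.sqrt (1 / 2) ≤ Real.sqrt (1 - c₁ * (D₁ + Ψ₁) ^ 2 * (s - t₀)) :=
      Real.sqrt_le_sqrt hden
    have hhalf : 0 < Real.sqrt (1 / 2) := Real.sqrt_pos.2 (by norm_num)
    have hnum : 0 ≤ Real.exp (∫ r in t₀..s, (4 * G r + 3 * κ * σ₂ r)) * (D₁ + Ψ₁) := by positivity
    calc Real.exp (∫ r in t₀..s, (4 * G r + 3 * κ * σ₂ r)) * (D₁ + Ψ₁) /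
          Real.sqrt (1 - c₁ * (D₁ + Ψ₁) ^ 2 * (s - t₀))
        ≤ Real.exp (∫ r in t₀..s, (4 * G r + 3 * κ * σ₂ r)) * (D₁ + Ψ₁) / Real.sqrt (1 / 2) :=
          div_le_div_of_nonneg_left hnum hhalf hsq
      _ = Real.sqrt 2 * (Real.exp (∫ r in t₀..s, (4 * G r + 3 * κ * σ₂ r)) * (D₁ + Ψ₁)) := by
          have h2 : Real.sqrt (1 / 2) = 1 / Real.sqrt 2 := by
            rw [Real.sqrt_div' _ (by norm_num : (0 : ℝ) ≤ 2), Real.sqrt_one]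
          rw [h2]
          field_simp
  -- the packaged door
  have key := classicalNS_norm_sub_le_strain_window_R3 hν ht₀₁ hv hu hU hUt hp hV hVt hq hfD hgD hκ hμ hG
    hσ₂ hσ₃ hL hH₁ hψ₁ hψ₂ hGc hσ₂c hσ₃c hLc hX₁c hH₁c hψ₁c hψ₂c hD₁ hΨ₁ hD₂ hΨ₂
    (by rw [← hc₁]; exact hsmall₁) (fun s hs => by rw [← hc₁]; exact hdom s hs)
    (by rw [← hc₂]; exact hsmall₂) ht x
  rw [← hc₂] at key
  refine key.trans (mul_le_mul_of_nonneg_left (Real.rpow_le_rpow ?_ ?_ (by norm_num)) hA0)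
  · -- nonnegativity of the exact base
    have hden : 0 < 1 - c₂ * (D₂ + Ψ₂) * (t - t₀) := by
      have : c₂ * (D₂ + Ψ₂) * (t - t₀) ≤ c₂ * (D₂ + Ψ₂) * (t₁ - t₀) :=
        mul_le_mul_of_nonneg_left (sub_le_sub_right ht.2 _) (by positivity)
      linarith
    have := hX₁0 t ht
    positivity
  · -- `1/(1 − c₂η₂(t − t₀)) ≤ 2`
    have hden : 1 / 2 ≤ 1 - c₂ * (D₂ + Ψ₂) * (t - t₀) := by
      have : c₂ * (D₂ + Ψ₂) * (t - t₀) ≤ c₂ * (D₂ + Ψ₂) * (t₁ - t₀) :=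
        mul_le_mul_of_nonneg_left (sub_le_sub_right ht.2 _) (by positivity)
      linarith
    have hnum : 0 ≤ Real.exp (∫ s in t₀..t, (6 * G s + 9 * κ * σ₂ s + 3 * κ ^ 2 * σ₃ s +
        3 * agmonConst ^ 2 * X₁ s / (ν * μ) + 27 * agmonConst ^ 4 * X₁ s ^ 2 / (16 * ν ^ 3))) *
        (D₂ + Ψ₂) := by positivity
    refine mul_le_mul_of_nonneg_left ?_ (by have := hX₁0 t ht; positivity)
    calc Real.exp (∫ s in t₀..t, (6 * G s + 9 * κ * σ₂ s + 3 * κ ^ 2 * σ₃ s +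
            3 * agmonConst ^ 2 * X₁ s / (ν * μ) + 27 * agmonConst ^ 4 * X₁ s ^ 2 / (16 * ν ^ 3))) *
            (D₂ + Ψ₂) / (1 - c₂ * (D₂ + Ψ₂) * (t - t₀))
        ≤ Real.exp (∫ s in t₀..t, (6 * G s + 9 * κ * σ₂ s + 3 * κ ^ 2 * σ₃ s +
            3 * agmonConst ^ 2 * X₁ s / (ν * μ) + 27 * agmonConst ^ 4 * X₁ s ^ 2 / (16 * ν ^ 3))) *
            (D₂ + Ψ₂) / (1 / 2) := div_le_div_of_nonneg_left hnum (by norm_num) hden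
      _ = 2 * (Real.exp (∫ s in t₀..t, (6 * G s + 9 * κ * σ₂ s + 3 * κ ^ 2 * σ₃ s +
            3 * agmonConst ^ 2 * X₁ s / (ν * μ) + 27 * agmonConst ^ 4 * X₁ s ^ 2 / (16 * ν ^ 3))) *
            (D₂ + Ψ₂)) := by ring

end SupDoorSimple

end Literature.Analysis.FluidPDE

end
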